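import Mathlib
import Summits.Langlands.Langlands.Theses.PicardMuOrdinary
import Literature.NumberTheory.GaloisRepresentations.GaloisRep
import Literature.NumberTheory.Automorphic.ReciprocityGLnProofs
import Literature.NumberTheory.Automorphic.AsaiSign
import Literature.NumberTheory.Automorphic.BaseChangeCyclicCuspidal
import Literature.NumberTheory.Automorphic.BaseChangeStrongUnramified
import Literature.NumberTheory.Automorphic.BaseChangeArchimedean
import Literature.NumberTheory.Automorphic.GLnAdelicStructureProofs
import Summits.Langlands.Langlands.Theorems.PicardMuOrdinaryIrregularClassicalityBaseChangeToLField
import Summits.Langlands.Langlands.Theorems.PicardMuOrdinaryIrregularClassicalityBaseChangeToLTower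
import Summits.Langlands.Langlands.Theorems.PicardMuOrdinaryIrregularClassicalityBaseChangeToL
import HarnessLib

/-!
# Stub `stub_baseChangeToL` of line `split-ramified-prime-sqrt6`, AVATAR form (reshape r8): base change
# of a polarized tower WITH GALOIS AVATARS to `L = K(√-2)` — Harris–Lan–Taylor–Thorne no longer needed

Crux `Summit.Langlands.Langlands.Theses.PicardMuOrdinary.IrregularClassicality` (stmt-Langlands-13758),
line `split-ramified-prime-sqrt6`.  `K = ℚ(ω) = CyclotomicField 3 ℚ`, `ℚ̄₃ = PadicAlgCl 3`.

The landed Stub 4 (`stub_baseChangeToL`, file `…BaseChangeToL`) base-changes a `c₀`-polarized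
congruence tower `(P_k)` on `GL₃(𝔸_K)` (given in the `𝔐`-currency, WITHOUT Galois representations) to
the CM field `L = K(√-2)` in Galois-convergent form, conditionally on FOUR named facts; the fourth,
`exists_galoisRep_of_regularAlgebraic` (lang.S27: Harris–Lan–Taylor–Thorne + Varma), is used only to
attach to each `P_k` a Galois representation `r_k` over `K`, compatible with `P_k` at the unramified
places off `3`, which is then restricted to `Γ_L`.

Since reshape r6 the tower that the composition actually feeds to Stub 4 is the ORDINARY polarized tower
of the interface stub (`OrdPolarizedTower` of the skeleton), whose members come WITH avatars: framed
`r_k : Γ_K → GL₃(ℚ̄₃)`, unramified and Galois-compatible with `P_k` (`IsGaloisCompatibleAt`, the HLTT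
normalisation) at every `𝔭 ∉ S`, and with the congruence in the `ι`-currency
`‖ι⁻¹(N𝔭·ΣSat(P_k,𝔭) − a 𝔭)‖ ≤ 3^{-k}`.  For such a tower the base change needs only the three
Arthur–Clozel facts:

* `baseChange_cyclic_cuspidal` — Arthur–Clozel, Ch. 3 Thm. 4.2 (a) (cuspidality of the quadratic base
  change of a `P` with `P ≇ P ⊗ η`);
* `ArthurClozel1989_strongLifting_unramified` — Thm. 5.1 at the finite places unramified in `L/K`
  (`Sat(Π, w) = Sat(P, v)^{f(w|v)}`; makes the level `S_L` independent of `k`);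
* `ArthurClozel1989_strongLifting_archimedean` — Thm. 5.1, archimedean clause (regular algebraicity
  ascends).

**Proof** (`tower_baseChange_ord`, for any quadratic `E/F` of number fields with compatible
involutions `c|_F = c₀`): verbatim the landed `tower_baseChange`, except that step (3) takes the avatar
`r_k` of the `k`-th member instead of `r_{3,ι}(P_k)`: `S_E := {w : w ∩ 𝓞 F ∈ S ∪ S₀ ∪ Ram(E/F)}`;
(1) an inert good place with `-α ≠ α` (odd rank) makes `Π_k := BC_{E/F}(P_k)` cuspidal; (2) `Π_k` is an
unramified strong lift, hence regular algebraic, unramified off `S_E`, conjugate self-dual for `c`;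
(3) at `w ∉ S_E` over `v ∉ S ∪ S₀` the compatibility of `r_k` with `P_k` at `v` restricts to
compatibility of `r_k|_{Γ_E}` with `Π_k` at `w` (`isGaloisCompatibleAt_restrictField`); (4) at every
arithmetic Frobenius `σ` over `v ∉ S ∪ S₀`, `tr r_k(σ⁻¹) = ι⁻¹(N v·Σα_v)` (compatibility) and
`tr ρ(σ⁻¹) = ι⁻¹(a v)`, so `‖tr r_k(σ⁻¹) − tr ρ(σ⁻¹)‖ = ‖ι⁻¹ t‖ ≤ 3^{-k}`; Chebotarev density
(`norm_trace_sub_le_of_frobenius`, from the tree's proved `frobenius_dense` /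
`chebotarev_artinRep_holds`) and continuity give the bound on `Γ_F`, in particular on `Γ_E`.
Neither the CM hypothesis on `F` nor a maximal ideal `𝔐` is needed any more.

Then `stub_baseChangeToL_ord` specialises to `F = K`, `E = L = K[X]/(X² + 2)` with `s = √-2`, `c`,
`IsCMField L`, `[L : K] = 2` (`exists_cmField_sqrt_neg_two`, support file `…BaseChangeToLField`) and
`hcptL = isCompact_glFiniteIntegralLevel_holds`; its conclusion is VERBATIM that of the landed
`stub_baseChangeToL` (the shape consumed by the heart `stub_twoWallOrdinaryClassicalityOrd`), its tower
hypothesis is `OrdPolarizedTower` of the skeleton with the ordinarity clause forgotten.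

References: J. Arthur, L. Clozel, Ann. of Math. Stud. 120 (1989), Ch. 3, Thm. 4.2 (a), Thm. 5.1;
J.-P. Serre, *Abelian ℓ-adic representations* (1968), Ch. I §2.2 (Chebotarev density of Frobenii).
-/

open scoped MatrixGroups Classical
open Literature.NumberTheory.GaloisRepresentations Literature.NumberTheory.Automorphic
open IsDedekindDomain NumberField Polynomial Filter

set_option linter.dupNamespace false -- project-wide: `Summit.Langlands.Langlands` is the mandated namespace

noncomputable section

namespace Summit.Langlands.Langlands.Theorems.IrregularClassicality.SplitRamifiedPrimeSqrt6

/-! ## The general tower theorem along a quadratic extension, avatar form -/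

/-- **Base change of a polarized congruence tower WITH GALOIS AVATARS along a quadratic extension
`E/F`**, in Galois-convergent form, from the three Arthur–Clozel facts only: given, for every `k`, a
cuspidal regular algebraic `c₀`-conjugate-self-dual `P_k` on `GL₃(𝔸_F)` with a framed `r_k` unramified
and Galois-compatible with `P_k` off `S` and `‖ι⁻¹(N𝔭·ΣSat(P_k,𝔭) − a 𝔭)‖ ≤ 3^{-k}` off `S`, and a
framed `ρ` with geometric-Frobenius traces `ι⁻¹(a 𝔭)` off `S₀ ⊇ {v ∣ 3}`, there are a level `S_E`
(independent of `k`, containing the places over `3` and over `S₀`) and, for every `k`, a cuspidal regular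
algebraic `c`-conjugate-self-dual `Π_k` on `GL₃(𝔸_E)` unramified and compatible with `r_k|_{Γ_E}` outside
`S_E`, with `‖tr r_k|_{Γ_E} − tr ρ|_{Γ_E}‖ ≤ 3^{-k}` on all of `Γ_E`.  See the module docstring;
Harris–Lan–Taylor–Thorne is not used. -/
theorem tower_baseChange_ord (h₁ : baseChange_cyclic_cuspidal)
    (h₂ : ArthurClozel1989_strongLifting_unramified) (h₃ : ArthurClozel1989_strongLifting_archimedean)
    {F E : Type} [Field F] [NumberField F] [Field E] [NumberField E] [Algebra F E]
    (h2 : Module.finrank F E = 2)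
    {c : E ≃ₐ[ℚ] E} {c₀ : F ≃ₐ[ℚ] F} (hcc₀ : ∀ x : F, c (algebraMap F E x) = algebraMap F E (c₀ x))
    (ι : PadicAlgCl 3 ≃+* ℂ)
    (hcpt : isCompact_glFiniteIntegralLevel 3 F) (hcptE : isCompact_glFiniteIntegralLevel 3 E)
    (S S₀ : Finset (HeightOneSpectrum (𝓞 F))) (a : HeightOneSpectrum (𝓞 F) → ℂ)
    (ρ : FramedGaloisRep F (PadicAlgCl 3) 3)
    (hS₀ : ∀ v : HeightOneSpectrum (𝓞 F), ((3 : ℕ) : 𝓞 F) ∈ v.asIdeal → v ∈ S₀)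
    (hρ : ∀ 𝔭 ∉ S₀, ρ.IsUnramifiedAt 𝔭 ∧
      ∀ 𝔓 ∈ 𝔭.primesAbove, ∀ τ : Field.absoluteGaloisGroup F,
        IsArithFrobAt (𝓞 F) τ 𝔓 → FramedRep.trace ρ τ⁻¹ = ι.symm (a 𝔭))
    (htower : ∀ k : ℕ, ∃ (P : CuspidalAutomorphicRepData 3 F hcpt) (r : FramedGaloisRep F (PadicAlgCl 3) 3),
      P.1.IsRegularAlgebraic ∧ P.1.IsConjSelfDualAE c₀ ∧
      ∀ 𝔭 ∉ S, IsGaloisCompatibleAt P.1 ι r 𝔭 ∧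
        ∃ (α : Multiset ℂ) (t : integralClosure ℤ ℂ), P.1.HasSatakeParamAt 𝔭 α ∧
          (t : ℂ) = (𝔭.residueCard : ℂ) * α.sum - a 𝔭 ∧ ‖ι.symm (t : ℂ)‖ ≤ ((3 : ℝ)⁻¹) ^ k) :
    ∃ S_E : Finset (HeightOneSpectrum (𝓞 E)),
      (∀ w : HeightOneSpectrum (𝓞 E), ((3 : ℕ) : 𝓞 E) ∈ w.asIdeal → w ∈ S_E) ∧
      (∀ w : HeightOneSpectrum (𝓞 E), w.under (𝓞 F) ∈ S₀ → w ∈ S_E) ∧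
      ∀ k : ℕ, ∃ (P : CuspidalAutomorphicRepData 3 E hcptE) (r : FramedGaloisRep E (PadicAlgCl 3) 3),
        P.1.IsRegularAlgebraic ∧ P.1.IsConjSelfDualAE c ∧
        (∀ w ∉ S_E, P.1.IsUnramifiedAt w ∧ IsGaloisCompatibleAt P.1 ι r w) ∧
        ∀ g : Field.absoluteGaloisGroup E,
          ‖FramedRep.trace r g - FramedRep.trace (ρ.restrictField E) g‖ ≤ ((3 : ℝ)⁻¹) ^ k := by
  haveI : FiniteDimensional F E := Module.finite_of_finrank_eq_succ h2
  haveI : Algebra.IsQuadraticExtension F E := ⟨h2⟩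
  haveI : IsGalois F E := inferInstance
  have hprime : (Module.finrank F E).Prime := by rw [h2]; exact Nat.prime_two
  -- the level over `E`: places over `T = S ∪ S₀ ∪ Ram(E/F)`
  have hfinR : {v : HeightOneSpectrum (𝓞 F) | ¬ Algebra.IsUnramifiedIn (𝓞 E) v.asIdeal}.Finite :=
    finite_setOf_not_isUnramifiedIn F E
  set T : Finset (HeightOneSpectrum (𝓞 F)) := S ∪ S₀ ∪ hfinR.toFinset with hT
  have hfinE : {w : HeightOneSpectrum (𝓞 E) | w.under (𝓞 F) ∈ T}.Finite := by
    refine (Set.Finite.biUnion T.finite_toSet fun v _ => finite_setOf_under_eq (M := E) v).subset ?_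
    intro w hw
    exact Set.mem_biUnion hw rfl
  have hmemT : ∀ w : HeightOneSpectrum (𝓞 E), w ∉ hfinE.toFinset →
      w.under (𝓞 F) ∉ S ∧ w.under (𝓞 F) ∉ S₀ ∧
        Algebra.IsUnramifiedIn (𝓞 E) (w.under (𝓞 F)).asIdeal := by
    intro w hw
    simp only [Set.Finite.mem_toFinset, Set.mem_setOf_eq, hT, Finset.mem_union, not_or,
      not_not] at hw
    exact ⟨hw.1.1, hw.1.2, hw.2⟩
  have h3under : ∀ w : HeightOneSpectrum (𝓞 E), ((3 : ℕ) : 𝓞 E) ∈ w.asIdeal →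
      ((3 : ℕ) : 𝓞 F) ∈ (w.under (𝓞 F)).asIdeal := fun w hw => by
    rw [HeightOneSpectrum.under_asIdeal, Ideal.under, Ideal.mem_comap, map_natCast]
    exact hw
  refine ⟨hfinE.toFinset, fun w hw => ?_, fun w hw => ?_, fun k => ?_⟩
  · rw [Set.Finite.mem_toFinset, Set.mem_setOf_eq, hT, Finset.mem_union, Finset.mem_union]
    exact Or.inl (Or.inr (hS₀ _ (h3under w hw)))
  · rw [Set.Finite.mem_toFinset, Set.mem_setOf_eq, hT, Finset.mem_union, Finset.mem_union]
    exact Or.inl (Or.inr hw)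
  -- the `k`-th member of the tower, its avatar, and its cuspidal base change
  obtain ⟨P, rF, hPreg, hPcsd, hPS⟩ := htower k
  obtain ⟨v₁, w₁, α₁, hw₁, hf₁, hα₁, hne₁⟩ := exists_inert_hasSatakeParamAt h2 (by decide) P.1
  obtain ⟨BC, hBC⟩ := h₁ 3 F E hprime hcpt P ⟨v₁, w₁, α₁, hw₁, hf₁, hα₁, hne₁⟩ hcptE
  have hU : IsUnramifiedBaseChangeLift P.1 BC.1 := h₂.isUnramifiedBaseChangeLift hprime hBC
  have hBCreg : BC.1.IsRegularAlgebraic := hU.isRegularAlgebraic h₃ hprime hPreg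
  refine ⟨BC, rF.restrictField E, hBCreg, isConjSelfDualAE_of_isUnramifiedBaseChangeLift hU hcc₀ hPcsd,
    fun w hw => ?_, fun g => ?_⟩
  · -- unramifiedness and compatibility at `w ∉ S_E`
    obtain ⟨hwS, hwS₀, hwu⟩ := hmemT w hw
    obtain ⟨hcompat, α, -, hα, -⟩ := hPS _ hwS
    refine ⟨hU.isUnramifiedAt (v := w.under (𝓞 F)) rfl hwu ⟨α, hα⟩, ?_⟩
    exact isGaloisCompatibleAt_restrictField P.1 BC.1 ι rF (v := w.under (𝓞 F)) rfl hα
      (hU w (w.under (𝓞 F)) α rfl hwu hα) fun β hβ => hcompat β hβ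
  · -- the sup-norm bound, over `Γ_F` by density of the Frobenii off `S ∪ S₀`, then on `Γ_E`
    have hF : ∀ g : Field.absoluteGaloisGroup F,
        ‖FramedRep.trace rF g - FramedRep.trace ρ g‖ ≤ ((3 : ℝ)⁻¹) ^ k := by
      refine norm_trace_sub_le_of_frobenius (↑(S ∪ S₀) : Set (HeightOneSpectrum (𝓞 F)))
        (S ∪ S₀).finite_toSet rF ρ _ fun v hv 𝔓 h𝔓 σ hσ => ?_
      simp only [Finset.coe_union, Set.mem_union, Finset.mem_coe, not_or] at hv
      obtain ⟨hvS, hvS₀⟩ := hv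
      obtain ⟨hcompat, α, t, hα, ht, hnorm⟩ := hPS v hvS
      rw [trace_inv_eq_of_isGaloisCompatibleAt ι hcompat hα h𝔓 hσ,
        (hρ v hvS₀).2 𝔓 h𝔓 σ hσ, ← map_sub, ← ht]
      exact hnorm
    exact hF (absGaloisRestrict F E g)

/-! ## The stub, avatar form, conditionally on the three Arthur–Clozel facts -/

/-- **Stub 4 of the line `split-ramified-prime-sqrt6` in AVATAR form (`stub_baseChangeToL_ord`,
reshape r8), CONDITIONAL on the three named facts** `baseChange_cyclic_cuspidal`,
`ArthurClozel1989_strongLifting_unramified`, `ArthurClozel1989_strongLifting_archimedean` (and NOT on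
`exists_galoisRep_of_regularAlgebraic`): the input is the ORDINARY `c₀`-polarized tower of the
skeleton's interface stub with its ordinarity clause forgotten — members `P_k` regular algebraic
cuspidal, `IsConjSelfDualAE c₀`, each with a framed avatar `r_k` unramified and Galois-compatible off
`S` and `‖ι⁻¹(N𝔭·ΣSat(P_k,𝔭) − a 𝔭)‖ ≤ 3^{-k}` off `S` — and the output is VERBATIM the conclusion of
the landed `stub_baseChangeToL`: the CM field `L = K[X]/(X² + 2) ⊇ K`, `s = √-2`, the involution `c`
(`s ↦ -s`, `c|_K = c₀`) of `exists_cmField_sqrt_neg_two`, `hcptL = isCompact_glFiniteIntegralLevel_holds`,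
a level `S_L ⊇ {w ∣ 3} ∪ {w ∣ S₀}` and the Galois-convergent polarized tower over `L`
(`tower_baseChange_ord` for `E = L`, `F = K`). -/
theorem stub_baseChangeToL_ord :
    baseChange_cyclic_cuspidal → ArthurClozel1989_strongLifting_unramified →
    ArthurClozel1989_strongLifting_archimedean →
    ∀ (ι : PadicAlgCl 3 ≃+* ℂ) (hcpt : isCompact_glFiniteIntegralLevel 3 (CyclotomicField 3 ℚ))
      (c₀ : CyclotomicField 3 ℚ ≃ₐ[ℚ] CyclotomicField 3 ℚ), c₀ ≠ 1 →
    ∀ (S S₀ : Finset (HeightOneSpectrum (𝓞 (CyclotomicField 3 ℚ))))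
      (a : HeightOneSpectrum (𝓞 (CyclotomicField 3 ℚ)) → ℂ)
      (ρ : FramedGaloisRep (CyclotomicField 3 ℚ) (PadicAlgCl 3) 3),
      (∀ v : HeightOneSpectrum (𝓞 (CyclotomicField 3 ℚ)),
        ((3 : ℕ) : 𝓞 (CyclotomicField 3 ℚ)) ∈ v.asIdeal → v ∈ S₀) →
      (∀ 𝔭 ∉ S₀, ρ.IsUnramifiedAt 𝔭 ∧
        ∀ 𝔓 ∈ 𝔭.primesAbove, ∀ τ : Field.absoluteGaloisGroup (CyclotomicField 3 ℚ),
          IsArithFrobAt (𝓞 (CyclotomicField 3 ℚ)) τ 𝔓 → FramedRep.trace ρ τ⁻¹ = ι.symm (a 𝔭)) →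
      (∀ k : ℕ, ∃ (P : CuspidalAutomorphicRepData 3 (CyclotomicField 3 ℚ) hcpt)
        (r : FramedGaloisRep (CyclotomicField 3 ℚ) (PadicAlgCl 3) 3),
        P.1.IsRegularAlgebraic ∧ P.1.IsConjSelfDualAE c₀ ∧
        ∀ 𝔭 ∉ S, P.1.IsUnramifiedAt 𝔭 ∧ IsGaloisCompatibleAt P.1 ι r 𝔭 ∧
          ∃ (α : Multiset ℂ) (t : integralClosure ℤ ℂ), P.1.HasSatakeParamAt 𝔭 α ∧
            (t : ℂ) = (𝔭.residueCard : ℂ) * α.sum - a 𝔭 ∧ ‖ι.symm (t : ℂ)‖ ≤ ((3 : ℝ)⁻¹) ^ k) →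
    ∃ (L : Type) (_ : Field L) (_ : NumberField L) (_ : Algebra (CyclotomicField 3 ℚ) L)
      (s : L) (c : L ≃ₐ[ℚ] L) (hcptL : isCompact_glFiniteIntegralLevel 3 L)
      (S_L : Finset (HeightOneSpectrum (𝓞 L))),
      NumberField.IsCMField L ∧ s ^ 2 = -2 ∧ Module.finrank (CyclotomicField 3 ℚ) L = 2 ∧
      c s = -s ∧
      (∀ x : CyclotomicField 3 ℚ,
        c (algebraMap (CyclotomicField 3 ℚ) L x) = algebraMap (CyclotomicField 3 ℚ) L (c₀ x)) ∧
      (∀ w : HeightOneSpectrum (𝓞 L), ((3 : ℕ) : 𝓞 L) ∈ w.asIdeal → w ∈ S_L) ∧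
      (∀ w : HeightOneSpectrum (𝓞 L), w.under (𝓞 (CyclotomicField 3 ℚ)) ∈ S₀ → w ∈ S_L) ∧
      ∀ k : ℕ, ∃ (P : CuspidalAutomorphicRepData 3 L hcptL)
        (r : FramedGaloisRep L (PadicAlgCl 3) 3),
        P.1.IsRegularAlgebraic ∧ P.1.IsConjSelfDualAE c ∧
        (∀ w ∉ S_L, P.1.IsUnramifiedAt w ∧ IsGaloisCompatibleAt P.1 ι r w) ∧
        ∀ g : Field.absoluteGaloisGroup L,
          ‖FramedRep.trace r g - FramedRep.trace (ρ.restrictField L) g‖ ≤ ((3 : ℝ)⁻¹) ^ k := by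
  intro h₁ h₂ h₃ ι hcpt c₀ hc₀ S S₀ a ρ hS₀ hρ htower
  obtain ⟨L, _, _, _, s, c, hCM, hs, h2, hcs, hcc₀⟩ := exists_cmField_sqrt_neg_two c₀ hc₀
  obtain ⟨S_L, hSL3, hSLS₀, hk⟩ := tower_baseChange_ord h₁ h₂ h₃ (F := CyclotomicField 3 ℚ) (E := L)
    h2 (c := c) (c₀ := c₀) hcc₀ ι hcpt (isCompact_glFiniteIntegralLevel_holds 3 L)
    S S₀ a ρ hS₀ hρ fun k => by
      obtain ⟨P, r, hreg, hcsd, hP⟩ := htower k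
      exact ⟨P, r, hreg, hcsd, fun 𝔭 h𝔭 => (hP 𝔭 h𝔭).2⟩
  exact ⟨L, inferInstance, inferInstance, inferInstance, s, c, isCompact_glFiniteIntegralLevel_holds 3 L,
    S_L, hCM, hs, h2, hcs, hcc₀, hSL3, hSLS₀, hk⟩

end Summit.Langlands.Langlands.Theorems.IrregularClassicality.SplitRamifiedPrimeSqrt6

end
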